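import Summits.QuantumFields.YangMills.Theorems.BalabanUVNodesN15KingModelGraphPowerCountingRelabel

/-!
# BalabanUVNodes ∕ N15 — THE KING-MODEL RUNG (PART Γ-k): KRUSKAL's TREE LINES OF AN ORDERING — King's shrinking procedure as component LABELS: which lines reach a
# new point (tree lines) and which close a loop, that equal labels are joined by tree lines, that a connected graph shrinks to ONE point, and that it then has
# exactly `nn` tree lines («points + tree lines = vertices») — the combinatorial half of discharging the certificates of parts Γ-g–Γ-i
# (Track A, DAG node N15 = NE2; FAN-OUT v1.1 §N15 s3 «KING-MODEL RUNG … NE2's analogue DECIDED in the model»)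

HONEST FRAMING.  Count-neutral (cell `pub-ymgap`, seat `pub-ymgap-dag-n15-e` g27; `--supports stmt-QuantumFields-27366 --as helper` = K3⁸
`SpineGivenEndpointR13SepCoPHV`).  TEMPLATE LITERATURE: C. King, *The U(1) Higgs model. I. The continuum limit*, Commun. Math. Phys. **102** (1986) 649–677
[King1986], proof of Proposition 3.6, pp. 663–664.  Parts Γ-g–Γ-i prove (3.56) for general graphs given, per ordering, a relabelled spanning-forest certificate
with positive partial degrees — user data.  King's text DETERMINES the tree lines: along the ordering, `l(i)` either joins two vertices already shrunk to the same
point (a loop line) or two different points, which it merges («we have shrunk l(1) to a point»).  THIS FILE types that procedure as Kruskal's component labels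
and proves its invariants; part Γ-l builds the certificate from it (breadth-first numbering) and restates (3.56) in King's own hypothesis (3.77).  Elementary
combinatorics on `Fin (nn+1)` (no Mathlib graph library); NOT Bałaban's `G(U)`; NOT a node discharge; nothing continuum ∕ ℝ⁴ ∕ OS ∕ mass-gap ∕ Clay.  0 `sorry`;
standard axioms.
THE PRINT.  p. 663 [PDF 15] (foot): *«For a fixed ordering l we define a sequence of subgraphs H₁, …, H_m as follows: H₁ = {the line l(1) and its two vertices},
H_{i+1} = H_i ∪ {the line l(i+1) and its two vertices}. (3.66)»*; p. 664 [PDF 16]: *«Let x, y be the endpoints of the graph H₁ = l(1) … We then sum over y …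
Graphically, we have shrunk l(1) to a point in H; the remaining vertices are summed … We continue doing this … eventually shrinking H to one point x.»*
WHAT THIS FILE PROVES (namespace `…N15KingModelRung.Graph`; vertices `Fin (nn+1)`, external vertex `0`; lines `Fin m` with `src`, `tgt`; ordering `π`).
* `klab src tgt π p : Fin (nn+1) → Fin (nn+1)` — the POINT (component label) of each vertex after the first `p` lines have been shrunk (`klab_succ_of_lt`∕`_of_le`);
  `IsTreePos π p` (the line at position `p` joins two different points), `kruskalTree` ∕ `kruskalTreeUpTo p` (the tree lines ∕ those among the first `p`),
  `LAdj`∕`LConn T` (adjacency ∕ connectedness through a line set `T`, an `EqvGen`).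
* ★ `klab_eq_mono` (labels only merge), `klab_src_eq_tgt` (a processed line is internal to a point), ★ `klab_final_eq` (a CONNECTED graph shrinks to ONE point),
  `mem_kruskalTreeUpTo`, `kruskalTree_eq_upTo`, `kruskalTreeUpTo_mono`, `lConn_mono`, ★★ `lConn_of_klab_eq` (EQUAL LABELS ARE JOINED BY TREE LINES among the first
  `p` positions — the merge invariant), ★ `lConn_kruskalTree` (every vertex of a connected graph is joined to `0` by Kruskal's tree lines).
* Counting: `kruskalTreeUpTo_succ`∕`_succ_of_le`, `not_mem_kruskalTreeUpTo_self`, ★ `image_klab_succ_of_merge` (a merge removes exactly the merged label),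
  ★★ `card_image_klab_add` (`#points(p) + #tree lines(p) = nn + 1`), ★★ **`card_kruskalTree`** (a connected graph has exactly `nn` tree lines).
HONEST SCOPE.  Combinatorics only; the certificate (numbering, `lo`, `tl`) and the King corollary are part Γ-l.  Kruskal's classification = King's «reaches a new
point ∕ closes a loop»; the identity `#tree lines among the first i = |V(H_i)| − c(H_i)` (so that the partial sums of `e + dV·[tree]` are King's `D(H_i)`) is the
content of `card_image_klab_add` read per prefix (the label image counts the points of the shrunk graph INCLUDING untouched vertices, each its own point).
Locators: [King1986] (3.66) p.663 (foot), p.664.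
-/
noncomputable section

namespace Summit.QuantumFields.YangMills.BalabanUVNodes.N15KingModelRung.Graph

open scoped BigOperators
open Finset

/-! ## §1 Kruskal's labels along an ordering: «a line reaching a new point» vs «a line closing a loop» -/

section Kruskal
variable {nn m : ℕ} (src tgt : Fin m → Fin (nn + 1)) (π : Equiv.Perm (Fin m))

/-- **KRUSKAL's COMPONENT LABELS** after the first `p` lines of the ordering `π` have been shrunk: initially every vertex is its own point; the line `l(p+1) = π p`
with endpoints `a, b` either joins two vertices of the same point (labels equal: it CLOSES A LOOP, nothing changes) or two different points — then the point of `b`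
is merged into the point of `a` («we have shrunk l(1) to a point in H»). [cite: King1986, (3.66) p.663, p.664 («Graphically, we have shrunk l(1) to a point in H»)] -/
def klab : ℕ → Fin (nn + 1) → Fin (nn + 1)
  | 0 => fun w => w
  | p + 1 => fun w =>
      if h : p < m then
        if klab p (src (π ⟨p, h⟩)) = klab p (tgt (π ⟨p, h⟩)) then klab p w
        else if klab p w = klab p (tgt (π ⟨p, h⟩)) then klab p (src (π ⟨p, h⟩)) else klab p w
      else klab p w

/-- **the position `p` carries a TREE line** (King: `l(p+1)` reaches a new point; Kruskal: its endpoints lie in different points of the shrunk graph).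
[cite: King1986, (3.66)–(3.68) p.664] -/
abbrev IsTreePos (p : Fin m) : Prop := klab src tgt π p (src (π p)) ≠ klab src tgt π p (tgt (π p))

/-- **KRUSKAL's TREE LINES OF THE ORDERING** (the lines at tree positions). [cite: King1986, (3.66) p.663, p.664] -/
def kruskalTree : Finset (Fin m) := ((univ : Finset (Fin m)).filter fun p => IsTreePos src tgt π p).image π

/-- the tree lines among the first `p` positions. [cite: King1986, (3.66) p.663] -/
def kruskalTreeUpTo (p : ℕ) : Finset (Fin m) := ((univ : Finset (Fin m)).filter fun q : Fin m => ((q : ℕ)) < p ∧ IsTreePos src tgt π q).image π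

/-- adjacency through a set of lines. [folklore] -/
def LAdj (T : Finset (Fin m)) (u v : Fin (nn + 1)) : Prop := ∃ ℓ ∈ T, src ℓ = u ∧ tgt ℓ = v

/-- connectedness through a set of lines (the equivalence closure of adjacency). [folklore] -/
def LConn (T : Finset (Fin m)) : Fin (nn + 1) → Fin (nn + 1) → Prop := Relation.EqvGen (LAdj src tgt T)

variable {src tgt π}

/-- the label update at a merge step is a function of the old label. [folklore] -/
theorem klab_succ_of_lt {p : ℕ} (h : p < m) (w : Fin (nn + 1)) :
    klab src tgt π (p + 1) w
      = if klab src tgt π p (src (π ⟨p, h⟩)) = klab src tgt π p (tgt (π ⟨p, h⟩)) then klab src tgt π p w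
        else if klab src tgt π p w = klab src tgt π p (tgt (π ⟨p, h⟩)) then klab src tgt π p (src (π ⟨p, h⟩)) else klab src tgt π p w := by
  show (if h : p < m then _ else _) = _
  rw [dif_pos h]

/-- after the ordering is exhausted the labels are frozen. [folklore] -/
theorem klab_succ_of_le {p : ℕ} (h : m ≤ p) (w : Fin (nn + 1)) : klab src tgt π (p + 1) w = klab src tgt π p w := by
  show (if h : p < m then _ else _) = _
  rw [dif_neg (not_lt.2 h)]

/-- ★ **LABELS ONLY MERGE**: equal labels stay equal. [folklore] -/
theorem klab_eq_mono {u v : Fin (nn + 1)} {p : ℕ} (huv : klab src tgt π p u = klab src tgt π p v) :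
    ∀ q, p ≤ q → klab src tgt π q u = klab src tgt π q v := by
  intro q hq
  induction q, hq using Nat.le_induction with
  | base => exact huv
  | succ q _ ih =>
      by_cases h : q < m
      · rw [klab_succ_of_lt h, klab_succ_of_lt h, ih]
      · rw [klab_succ_of_le (not_lt.1 h), klab_succ_of_le (not_lt.1 h), ih]

/-- **A PROCESSED LINE IS INTERNAL TO A POINT**: after step `q + 1` the endpoints of `π q` carry the same label (whether it merged or closed a loop), hence at
every later stage. [cite: King1986, p.664 («we have shrunk l(1) to a point»)] -/
theorem klab_src_eq_tgt (q : Fin m) : ∀ p, (q : ℕ) + 1 ≤ p → klab src tgt π p (src (π q)) = klab src tgt π p (tgt (π q)) := by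
  refine klab_eq_mono ?_
  rw [klab_succ_of_lt q.isLt, klab_succ_of_lt q.isLt]
  have hq : (⟨(q : ℕ), q.isLt⟩ : Fin m) = q := Fin.ext rfl
  rw [hq]
  by_cases h : klab src tgt π q (src (π q)) = klab src tgt π q (tgt (π q))
  · rw [if_pos h, if_pos h, h]
  · rw [if_neg h, if_neg h, if_neg h, if_pos rfl]

/-- **A CONNECTED GRAPH SHRINKS TO ONE POINT**: if every vertex is connected to the external vertex `0` through the lines, all final labels agree.
[cite: King1986, p.664 («eventually shrinking H to one point x»)] -/
theorem klab_final_eq (hconn : ∀ v, LConn src tgt univ 0 v) (v : Fin (nn + 1)) : klab src tgt π m v = klab src tgt π m 0 := by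
  have key : ∀ u w, LConn src tgt univ u w → klab src tgt π m u = klab src tgt π m w := by
    intro u w h
    induction h with
    | rel a b hab =>
        obtain ⟨ℓ, -, ha, hb⟩ := hab
        rw [← ha, ← hb, ← π.apply_symm_apply ℓ]
        exact klab_src_eq_tgt (π.symm ℓ) m (Nat.succ_le_of_lt (π.symm ℓ).isLt)
    | refl a => rfl
    | symm a b _ ih => exact ih.symm
    | trans a b c _ _ ih1 ih2 => exact ih1.trans ih2
  exact (key 0 v (hconn v)).symm

/-- membership in the tree lines up to `p`. [folklore] -/
theorem mem_kruskalTreeUpTo {p : ℕ} {ℓ : Fin m} : ℓ ∈ kruskalTreeUpTo src tgt π p ↔ ((π.symm ℓ : ℕ)) < p ∧ IsTreePos src tgt π (π.symm ℓ) := by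
  classical
  unfold kruskalTreeUpTo
  simp only [mem_image, mem_filter, mem_univ, true_and]
  constructor
  · rintro ⟨q, hq, rfl⟩; rwa [Equiv.symm_apply_apply]
  · intro h; exact ⟨π.symm ℓ, h, π.apply_symm_apply ℓ⟩

/-- the full Kruskal tree is the tree up to `m`. [folklore] -/
theorem kruskalTree_eq_upTo : kruskalTree src tgt π = kruskalTreeUpTo src tgt π m := by
  classical
  ext ℓ
  rw [mem_kruskalTreeUpTo]
  unfold kruskalTree
  simp only [mem_image, mem_filter, mem_univ, true_and]
  constructor
  · rintro ⟨q, hq, rfl⟩; rw [Equiv.symm_apply_apply]; exact ⟨q.isLt, hq⟩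
  · intro h; exact ⟨π.symm ℓ, h.2, π.apply_symm_apply ℓ⟩

/-- the tree set grows along the ordering. [folklore] -/
theorem kruskalTreeUpTo_mono {p q : ℕ} (hpq : p ≤ q) : kruskalTreeUpTo src tgt π p ⊆ kruskalTreeUpTo src tgt π q := fun ℓ h => by
  rw [mem_kruskalTreeUpTo] at h ⊢; exact ⟨lt_of_lt_of_le h.1 hpq, h.2⟩

/-- connectedness is monotone in the line set. [folklore] -/
theorem lConn_mono {T T' : Finset (Fin m)} (h : T ⊆ T') {u v : Fin (nn + 1)} (huv : LConn src tgt T u v) : LConn src tgt T' u v := by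
  induction huv with
  | rel a b hab =>
      obtain ⟨ℓ, hℓ, hab⟩ := hab
      exact Relation.EqvGen.rel a b ⟨ℓ, h hℓ, hab⟩
  | refl a => exact Relation.EqvGen.refl a
  | symm a b _ ih => exact ih.symm _ _
  | trans a b c _ _ ih1 ih2 => exact ih1.trans _ _ _ ih2

/-- ★ **EQUAL LABELS ARE CONNECTED BY TREE LINES**: two vertices in the same point of the shrunk graph after `p` steps are joined by a chain of tree lines among the
first `p` positions. [cite: King1986, p.664] -/
theorem lConn_of_klab_eq : ∀ (p : ℕ) (u v : Fin (nn + 1)), klab src tgt π p u = klab src tgt π p v → LConn src tgt (kruskalTreeUpTo src tgt π p) u v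
  | 0, u, v, h => by
      have huv : u = v := h
      rw [huv]; exact Relation.EqvGen.refl v
  | p + 1, u, v, h => by
      have mono : ∀ {a b}, LConn src tgt (kruskalTreeUpTo src tgt π p) a b → LConn src tgt (kruskalTreeUpTo src tgt π (p + 1)) a b :=
        fun hab => lConn_mono (kruskalTreeUpTo_mono (Nat.le_succ p)) hab
      by_cases hp : p < m
      · rw [klab_succ_of_lt hp, klab_succ_of_lt hp] at h
        set a := src (π ⟨p, hp⟩) with ha
        set b := tgt (π ⟨p, hp⟩) with hb
        by_cases hab : klab src tgt π p a = klab src tgt π p b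
        · rw [if_pos hab, if_pos hab] at h
          exact mono (lConn_of_klab_eq p u v h)
        · rw [if_neg hab, if_neg hab] at h
          -- the merge step: the new line is a tree line among the first `p + 1`
          have hline : LConn src tgt (kruskalTreeUpTo src tgt π (p + 1)) a b := by
            refine Relation.EqvGen.rel a b ⟨π ⟨p, hp⟩, ?_, rfl, rfl⟩
            rw [mem_kruskalTreeUpTo, Equiv.symm_apply_apply]
            exact ⟨Nat.lt_succ_self p, hab⟩
          by_cases hu : klab src tgt π p u = klab src tgt π p b <;> by_cases hv : klab src tgt π p v = klab src tgt π p b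
          · exact mono (lConn_of_klab_eq p u v (hu.trans hv.symm))
          · rw [if_pos hu, if_neg hv] at h
            -- u ~ b, a ~ v
            exact ((mono (lConn_of_klab_eq p u b hu)).trans _ _ _ (hline.symm _ _)).trans _ _ _ (mono (lConn_of_klab_eq p a v h))
          · rw [if_neg hu, if_pos hv] at h
            exact ((mono (lConn_of_klab_eq p u a h)).trans _ _ _ hline).trans _ _ _ (mono (lConn_of_klab_eq p b v hv.symm))
          · rw [if_neg hu, if_neg hv] at h
            exact mono (lConn_of_klab_eq p u v h)
      · rw [klab_succ_of_le (not_lt.1 hp), klab_succ_of_le (not_lt.1 hp)] at h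
        exact mono (lConn_of_klab_eq p u v h)

/-- ★ **EVERY VERTEX OF A CONNECTED GRAPH IS JOINED TO THE EXTERNAL VERTEX BY KRUSKAL's TREE LINES.** [cite: King1986, p.664] -/
theorem lConn_kruskalTree (hconn : ∀ v, LConn src tgt univ 0 v) (v : Fin (nn + 1)) : LConn src tgt (kruskalTree src tgt π) 0 v := by
  rw [kruskalTree_eq_upTo]
  exact lConn_of_klab_eq (π := π) m 0 v (klab_final_eq (π := π) hconn v).symm

/-! ### Counting: every tree line removes exactly one point -/

/-- the tree set up to `p + 1`. [folklore] -/
theorem kruskalTreeUpTo_succ {p : ℕ} (hp : p < m) :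
    kruskalTreeUpTo src tgt π (p + 1)
      = if IsTreePos src tgt π ⟨p, hp⟩ then insert (π ⟨p, hp⟩) (kruskalTreeUpTo src tgt π p) else kruskalTreeUpTo src tgt π p := by
  classical
  ext ℓ
  rw [mem_kruskalTreeUpTo]
  split_ifs with ht
  · rw [mem_insert, mem_kruskalTreeUpTo]
    constructor
    · rintro ⟨h1, h2⟩
      rcases Nat.lt_succ_iff_lt_or_eq.1 h1 with h | h
      · exact Or.inr ⟨h, h2⟩
      · left; rw [← π.apply_symm_apply ℓ]; congr 1; exact Fin.ext h
    · rintro (rfl | ⟨h1, h2⟩)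
      · rw [Equiv.symm_apply_apply]; exact ⟨Nat.lt_succ_self p, ht⟩
      · exact ⟨Nat.lt_succ_of_lt h1, h2⟩
  · rw [mem_kruskalTreeUpTo]
    constructor
    · rintro ⟨h1, h2⟩
      rcases Nat.lt_succ_iff_lt_or_eq.1 h1 with h | h
      · exact ⟨h, h2⟩
      · exfalso; apply ht
        have : π.symm ℓ = ⟨p, hp⟩ := Fin.ext h
        rwa [this] at h2
    · rintro ⟨h1, h2⟩; exact ⟨Nat.lt_succ_of_lt h1, h2⟩

/-- beyond the ordering nothing is added. [folklore] -/
theorem kruskalTreeUpTo_succ_of_le {p : ℕ} (hp : m ≤ p) : kruskalTreeUpTo src tgt π (p + 1) = kruskalTreeUpTo src tgt π p := by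
  ext ℓ
  rw [mem_kruskalTreeUpTo, mem_kruskalTreeUpTo]
  constructor
  · rintro ⟨-, h2⟩; exact ⟨lt_of_lt_of_le (π.symm ℓ).isLt hp, h2⟩
  · rintro ⟨h1, h2⟩; exact ⟨Nat.lt_succ_of_lt h1, h2⟩

/-- the new tree line is new. [folklore] -/
theorem not_mem_kruskalTreeUpTo_self {p : ℕ} (hp : p < m) : π ⟨p, hp⟩ ∉ kruskalTreeUpTo src tgt π p := fun h => by
  rw [mem_kruskalTreeUpTo, Equiv.symm_apply_apply] at h
  exact lt_irrefl p h.1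

/-- **AT A MERGE STEP THE SET OF POINTS LOSES EXACTLY THE MERGED LABEL.** [folklore] -/
theorem image_klab_succ_of_merge {p : ℕ} (hp : p < m) (ht : IsTreePos src tgt π ⟨p, hp⟩) :
    (univ : Finset (Fin (nn + 1))).image (klab src tgt π (p + 1)) = ((univ : Finset (Fin (nn + 1))).image (klab src tgt π p)).erase (klab src tgt π p (tgt (π ⟨p, hp⟩))) := by
  classical
  have hab : klab src tgt π p (src (π ⟨p, hp⟩)) ≠ klab src tgt π p (tgt (π ⟨p, hp⟩)) := ht
  ext c
  simp only [mem_image, mem_univ, true_and, mem_erase]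
  constructor
  · rintro ⟨w, rfl⟩
    rw [klab_succ_of_lt hp, if_neg hab]
    by_cases hw : klab src tgt π p w = klab src tgt π p (tgt (π ⟨p, hp⟩))
    · rw [if_pos hw]; exact ⟨hab, _, rfl⟩
    · rw [if_neg hw]; exact ⟨hw, _, rfl⟩
  · rintro ⟨hc, w, rfl⟩
    refine ⟨w, ?_⟩
    rw [klab_succ_of_lt hp, if_neg hab, if_neg hc]

/-- ★ **POINTS + TREE LINES = VERTICES**: `#(labels after p) + #(tree lines among the first p) = nn + 1` — every tree line shrinks the graph by exactly one point.
[cite: King1986, p.664 («we have shrunk l(1) to a point … eventually shrinking H to one point»)] -/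
theorem card_image_klab_add : ∀ p : ℕ, ((univ : Finset (Fin (nn + 1))).image (klab src tgt π p)).card + (kruskalTreeUpTo src tgt π p).card = nn + 1
  | 0 => by
      classical
      have h1 : (univ : Finset (Fin (nn + 1))).image (klab src tgt π 0) = univ := by
        ext w; simp only [mem_image, mem_univ, true_and, iff_true]; exact ⟨w, rfl⟩
      have h2 : kruskalTreeUpTo src tgt π 0 = ∅ := by
        ext ℓ; rw [mem_kruskalTreeUpTo]; simp
      rw [h1, h2, card_univ, Fintype.card_fin, card_empty, add_zero]
  | p + 1 => by
      classical
      have ih := card_image_klab_add p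
      by_cases hp : p < m
      · rw [kruskalTreeUpTo_succ hp]
        by_cases ht : IsTreePos src tgt π ⟨p, hp⟩
        · rw [if_pos ht, image_klab_succ_of_merge hp ht, card_insert_of_notMem (not_mem_kruskalTreeUpTo_self hp),
            card_erase_of_mem (mem_image_of_mem _ (mem_univ _))]
          have hpos : 0 < ((univ : Finset (Fin (nn + 1))).image (klab src tgt π p)).card := card_pos.2 ⟨_, mem_image_of_mem _ (mem_univ (0 : Fin (nn + 1)))⟩
          omega
        · have hlab : (univ : Finset (Fin (nn + 1))).image (klab src tgt π (p + 1)) = (univ : Finset (Fin (nn + 1))).image (klab src tgt π p) := by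
            have hab : klab src tgt π p (src (π ⟨p, hp⟩)) = klab src tgt π p (tgt (π ⟨p, hp⟩)) := not_not.1 ht
            ext c; simp only [mem_image, mem_univ, true_and]
            constructor
            · rintro ⟨w, rfl⟩; exact ⟨w, by rw [klab_succ_of_lt hp, if_pos hab]⟩
            · rintro ⟨w, rfl⟩; exact ⟨w, by rw [klab_succ_of_lt hp, if_pos hab]⟩
          rw [if_neg ht, hlab, ih]
      · have hlab : (univ : Finset (Fin (nn + 1))).image (klab src tgt π (p + 1)) = (univ : Finset (Fin (nn + 1))).image (klab src tgt π p) := by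
          ext c; simp only [mem_image, mem_univ, true_and]
          constructor
          · rintro ⟨w, rfl⟩; exact ⟨w, by rw [klab_succ_of_le (not_lt.1 hp)]⟩
          · rintro ⟨w, rfl⟩; exact ⟨w, by rw [klab_succ_of_le (not_lt.1 hp)]⟩
        rw [kruskalTreeUpTo_succ_of_le (not_lt.1 hp), hlab, ih]

/-- ★ **A CONNECTED GRAPH ON `nn + 1` VERTICES HAS EXACTLY `nn` KRUSKAL TREE LINES** (it shrinks to one point). [cite: King1986, p.664] -/
theorem card_kruskalTree (hconn : ∀ v, LConn src tgt univ 0 v) : (kruskalTree src tgt π).card = nn := by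
  classical
  have h := card_image_klab_add (src := src) (tgt := tgt) (π := π) m
  have h1 : (univ : Finset (Fin (nn + 1))).image (klab src tgt π m) = {klab src tgt π m 0} := by
    ext c; simp only [mem_image, mem_univ, true_and, mem_singleton]
    constructor
    · rintro ⟨w, rfl⟩; exact klab_final_eq hconn w
    · rintro rfl; exact ⟨0, rfl⟩
  rw [h1, card_singleton, ← kruskalTree_eq_upTo] at h
  omega

end Kruskal

end Summit.QuantumFields.YangMills.BalabanUVNodes.N15KingModelRung.Graph

end
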